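import Mathlib.MeasureTheory.Group.Measure
import Mathlib.MeasureTheory.Group.Integral
import Mathlib.MeasureTheory.Integral.Bochner.Basic
import Mathlib.MeasureTheory.Integral.Bochner.Set
import Mathlib.Topology.Algebra.InfiniteSum.Real
import HarnessLib

/-!
# A lattice sum of a `K`-invariant function is dominated by its integral: `Σ_{γ ∈ Γ} f(γ) ≤ |Γ ∩ K| · μ(K)⁻¹ · ∫ f`

Topic `MeasureTheory/Group`; namespace `Literature.MeasureTheory.Group`.  KERNEL only (Mathlib-only): proved theorems, no definition,
no named fact, no `sorry`.

Let `G` be a topological group with a left-invariant measure `μ` (positive on opens, finite on compacts — e.g. a Haar measure), `K` an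
OPEN subgroup of finite measure, `Γ ≤ G` a subgroup meeting `K` in a FINITE set, and `f : G → ℝ` a non-negative `μ`-integrable function
that is RIGHT-`K`-INVARIANT (`f(g k) = f(g)`).  Then the family `γ ↦ f(γ)` (`γ ∈ Γ`) is summable and

  `Σ_{γ ∈ Γ} f(γ) ≤ |Γ ∩ K| · μ(K)⁻¹ · ∫_G f dμ`.

PROOF («each point is covered at most `|Γ ∩ K|` times»): `f(γ) μ(K) = ∫_{γK} f` (`f` is constant on the coset `γK`, `μ(γK) = μ(K)`); the
`γ ∈ Γ` with `x ∈ γK` form a coset of `Γ ∩ K`, so `Σ_{γ ∈ S} 𝟙_{γK} ≤ |Γ ∩ K|` pointwise for every finite `S ⊆ Γ`; integrate against `f ≥ 0`.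
This is the standard comparison of the sum of a matrix coefficient over the rational points of an adelic group with its adelic integral
(the finite-adelic step of «lattice sums are dominated by integrals» for `K_f`-finite vectors; e.g. [Weil1965, n° 7–8] majorations, or the
proof of the absolute convergence of Poincaré ∕ theta-type series from the integrability of the generating coefficient, [Garrett2018, §2.2,
proof of Thm. 2.2.2 «counting the lattice points by the measure of a fundamental neighbourhood»]).

* `sum_indicator_smul_le` — the covering multiplicity: `Σ_{γ∈S} 𝟙_{γK}(x) ≤ |Γ ∩ K|`;
* `mul_measureReal_eq_integral_indicator_smul` — `f(γ) · μ(K) = ∫ 𝟙_{γK} f`;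
* `sum_le_card_mul_measureReal_inv_mul_integral` — the bound for every finite `S ⊆ Γ`;
* `summable_and_tsum_le_of_rightInvariant` — THE STATEMENT (summability + the bound).
* §4 (appended) `summable_and_tsum_le_translate_of_rightInvariant` — the translated sums `Σ_γ f(w γ)` obey the SAME bound for every
  `w ∈ G`; `summable_and_tsum_le_of_le_translate` — domination form (`0 ≤ t γ ≤ f(w γ)` ⇒ `Σ t ≤` the bound); `…_of_isCompact` variants.

Cell `hodgecm-mathlib`, FLOOR 0, E-2 desk, crux item H413, child line `Cruxes/H413/Lines/F0_E2SiegelWeilWeilRange.lean`, `stub_SW2_siegelWeil`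
conjunct (ii) (orbital sums of Weil matrix coefficients over `U(J_W)(F)`, dominated by the absolutely convergent adelic Rallis integral), piece
C-α.  HC_CM is proved only modulo the 7 printed citations until rung 0 closes; this file is unconditional and touches no binder.

## References
* [Garrett2018] P. Garrett, *Modern Analysis of Automorphic Forms by Example* (2018), §2.2 Thm. 2.2.2 (PDF pp. 81–84).
* [Weil1965] A. Weil, *Sur la formule de Siegel dans la théorie des groupes classiques*, Acta Math. 113 (1965), n° 7–8 (majorations),
  n° 40 Thm. 1 (p. 57).
-/

set_option autoImplicit false

noncomputable section

open MeasureTheory Set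
open scoped ENNReal Pointwise

namespace Literature.MeasureTheory.Group

variable {G : Type*} [Group G] [TopologicalSpace G] [IsTopologicalGroup G] [MeasurableSpace G] [BorelSpace G]

/-! ## §1 Covering multiplicity of the cosets `γK`, `γ ∈ Γ` -/

omit [TopologicalSpace G] [IsTopologicalGroup G] [MeasurableSpace G] [BorelSpace G] in
/-- If `x ∈ γ₁K` and `x ∈ γK` then `γ₁⁻¹ γ ∈ K`. [folklore] -/
private theorem inv_mul_mem_of_mem_smul_of_mem_smul (K : Subgroup G) {x γ₁ γ : G} (h₁ : x ∈ γ₁ • (K : Set G))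
    (h : x ∈ γ • (K : Set G)) : γ₁⁻¹ * γ ∈ K := by
  rw [mem_smul_set_iff_inv_smul_mem, smul_eq_mul] at h₁ h
  have : γ₁⁻¹ * γ = (γ₁⁻¹ * x) * (γ⁻¹ * x)⁻¹ := by group
  rw [this]
  exact K.mul_mem h₁ (K.inv_mem h)

omit [TopologicalSpace G] [IsTopologicalGroup G] [MeasurableSpace G] [BorelSpace G] in
/-- **Covering multiplicity**: for a finite `S ⊆ Γ`, every point `x` lies in at most `|Γ ∩ K|` of the cosets `γK`, `γ ∈ S` — in the form
`Σ_{γ ∈ S} 𝟙_{γK}(x) ≤ |Γ ∩ K|`. [cite: Garrett2018, §2.2 Thm. 2.2.2 (PDF p. 82)] -/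
theorem sum_indicator_smul_le (Γ K : Subgroup G) (hfin : ((Γ : Set G) ∩ (K : Set G)).Finite) (S : Finset Γ) (x : G) :
    ∑ γ ∈ S, ((γ : G) • (K : Set G)).indicator (fun _ => (1 : ℝ)) x ≤ hfin.toFinset.card := by
  classical
  have hsum : ∑ γ ∈ S, ((γ : G) • (K : Set G)).indicator (fun _ => (1 : ℝ)) x =
      ((S.filter fun γ : Γ => x ∈ (γ : G) • (K : Set G)).card : ℝ) := by
    rw [← Finset.sum_boole]
    exact Finset.sum_congr rfl fun γ _ => Set.indicator_apply _ _ _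
  rw [hsum, Nat.cast_le]
  set T := S.filter fun γ : Γ => x ∈ (γ : G) • (K : Set G) with hT
  by_cases hT0 : T = ∅
  · rw [hT0, Finset.card_empty]
    exact Nat.zero_le _
  obtain ⟨γ₁, hγ₁⟩ := Finset.nonempty_iff_ne_empty.2 hT0
  have hγ₁x : x ∈ (γ₁ : G) • (K : Set G) := (Finset.mem_filter.1 hγ₁).2
  -- `γ ↦ γ₁⁻¹ γ` maps `T` injectively into `Γ ∩ K`
  refine Finset.card_le_card_of_injOn (fun γ : Γ => ((γ₁ : G))⁻¹ * (γ : G)) (fun γ hγ => ?_) (fun γ _ γ' _ h => ?_)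
  · rw [Finset.mem_coe, Set.Finite.mem_toFinset]
    refine ⟨?_, ?_⟩
    · exact Γ.mul_mem (Γ.inv_mem γ₁.2) γ.2
    · exact inv_mul_mem_of_mem_smul_of_mem_smul K hγ₁x (Finset.mem_filter.1 (Finset.mem_coe.1 hγ)).2
  · exact Subtype.ext (mul_left_cancel h)

/-! ## §2 `f(γ) μ(K) = ∫ 𝟙_{γK} f` for right-`K`-invariant `f` -/

variable (μ : Measure G) [μ.IsMulLeftInvariant]

omit [TopologicalSpace G] [IsTopologicalGroup G] [MeasurableSpace G] [BorelSpace G] [μ.IsMulLeftInvariant] in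
/-- On the coset `γK` a right-`K`-invariant function is constant `= f(γ)`. [folklore] -/
private theorem eq_of_mem_smul (K : Subgroup G) {f : G → ℝ} (hfK : ∀ g k : G, k ∈ K → f (g * k) = f g) {γ x : G}
    (hx : x ∈ γ • (K : Set G)) : f x = f γ := by
  rw [mem_smul_set_iff_inv_smul_mem, smul_eq_mul] at hx
  have h := hfK γ (γ⁻¹ * x) hx
  rwa [mul_inv_cancel_left] at h

/-- **`f(γ) · μ(K) = ∫ 𝟙_{γK} · f dμ`** for a right-`K`-invariant `f` and a left-invariant `μ` (`K` open, hence measurable).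
[cite: Garrett2018, §2.2 Thm. 2.2.2 (PDF p. 82)] -/
theorem mul_measureReal_eq_integral_indicator_smul (K : Subgroup G) (hK : IsOpen (K : Set G)) {f : G → ℝ}
    (hfK : ∀ g k : G, k ∈ K → f (g * k) = f g) (γ : G) :
    f γ * μ.real (K : Set G) = ∫ x, (γ • (K : Set G)).indicator f x ∂μ := by
  have hmeas : MeasurableSet (γ • (K : Set G)) := (hK.smul γ).measurableSet
  rw [integral_indicator hmeas]
  have hconst : ∀ x ∈ γ • (K : Set G), f x = (fun _ => f γ) x := fun x hx => eq_of_mem_smul K hfK hx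
  rw [setIntegral_congr_fun hmeas hconst, setIntegral_const, smul_eq_mul, mul_comm, measureReal_def, measureReal_def,
    measure_smul]

/-! ## §3 The bound on finite partial sums and the theorem -/

/-- **Finite partial sums**: for right-`K`-invariant integrable `f ≥ 0`, `K` open of finite positive measure, `Γ ∩ K` finite,
`Σ_{γ ∈ S} f(γ) ≤ |Γ ∩ K| · μ(K)⁻¹ · ∫ f dμ` for every finite `S ⊆ Γ`. [cite: Garrett2018, §2.2 Thm. 2.2.2 (PDF p. 82)] -/
theorem sum_le_card_mul_measureReal_inv_mul_integral (Γ K : Subgroup G) (hK : IsOpen (K : Set G))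
    (hKpos : μ (K : Set G) ≠ 0) (hKfin : μ (K : Set G) ≠ ∞) (hfin : ((Γ : Set G) ∩ (K : Set G)).Finite) {f : G → ℝ}
    (hf0 : ∀ x, 0 ≤ f x) (hfK : ∀ g k : G, k ∈ K → f (g * k) = f g) (hfi : Integrable f μ) (S : Finset Γ) :
    ∑ γ ∈ S, f γ ≤ hfin.toFinset.card * (μ.real (K : Set G))⁻¹ * ∫ x, f x ∂μ := by
  classical
  have hKr : 0 < μ.real (K : Set G) := ENNReal.toReal_pos hKpos hKfin
  -- multiply by `μ(K)` and bound `Σ_{γ∈S} ∫ 𝟙_{γK} f = ∫ (Σ 𝟙_{γK}) f ≤ |Γ ∩ K| ∫ f`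
  have hmeas : ∀ γ : G, MeasurableSet (γ • (K : Set G)) := fun γ => (hK.smul γ).measurableSet
  have key : (∑ γ ∈ S, f γ) * μ.real (K : Set G) ≤ hfin.toFinset.card * ∫ x, f x ∂μ := by
    calc (∑ γ ∈ S, f γ) * μ.real (K : Set G) = ∑ γ ∈ S, ∫ x, ((γ : G) • (K : Set G)).indicator f x ∂μ := by
          rw [Finset.sum_mul]
          exact Finset.sum_congr rfl fun γ _ => mul_measureReal_eq_integral_indicator_smul μ K hK hfK γ
      _ = ∫ x, ∑ γ ∈ S, ((γ : G) • (K : Set G)).indicator f x ∂μ := by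
          rw [integral_finsetSum]
          exact fun γ _ => hfi.indicator (hmeas γ)
      _ ≤ ∫ x, (hfin.toFinset.card : ℝ) * f x ∂μ := by
          refine integral_mono (integrable_finsetSum _ fun γ _ => hfi.indicator (hmeas γ)) (hfi.const_mul _) fun x => ?_
          -- pointwise: `Σ_{γ∈S} 𝟙_{γK}(x) f(x) = (Σ_{γ∈S} 𝟙_{γK}(x)) · f(x) ≤ |Γ∩K| · f(x)`
          have hpt : ∑ γ ∈ S, ((γ : G) • (K : Set G)).indicator f x =
              (∑ γ ∈ S, ((γ : G) • (K : Set G)).indicator (fun _ => (1 : ℝ)) x) * f x := by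
            rw [Finset.sum_mul]
            refine Finset.sum_congr rfl fun γ _ => ?_
            by_cases hx : x ∈ (γ : G) • (K : Set G)
            · rw [Set.indicator_of_mem hx, Set.indicator_of_mem hx, one_mul]
            · rw [Set.indicator_of_notMem hx, Set.indicator_of_notMem hx, zero_mul]
          rw [hpt]
          exact mul_le_mul_of_nonneg_right (sum_indicator_smul_le Γ K hfin S x) (hf0 x)
      _ = hfin.toFinset.card * ∫ x, f x ∂μ := integral_const_mul _ _
  calc ∑ γ ∈ S, f γ = (∑ γ ∈ S, f γ) * μ.real (K : Set G) * (μ.real (K : Set G))⁻¹ := by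
        rw [mul_inv_cancel_right₀ hKr.ne']
    _ ≤ hfin.toFinset.card * (∫ x, f x ∂μ) * (μ.real (K : Set G))⁻¹ :=
        mul_le_mul_of_nonneg_right key (inv_nonneg.2 hKr.le)
    _ = hfin.toFinset.card * (μ.real (K : Set G))⁻¹ * ∫ x, f x ∂μ := by ring

/-- **LATTICE SUM ≤ INTEGRAL.**  Let `μ` be a left-invariant measure on the topological group `G`, `K` an open subgroup with
`0 < μ(K) < ∞`, `Γ ≤ G` a subgroup with `Γ ∩ K` finite, and `f ≥ 0` integrable and right-`K`-invariant.  Then `γ ↦ f(γ)` is summable over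
`Γ` and `Σ_{γ ∈ Γ} f(γ) ≤ |Γ ∩ K| · μ(K)⁻¹ · ∫_G f dμ`. [cite: Garrett2018, §2.2 Thm. 2.2.2 (PDF pp. 82–84)] -/
theorem summable_and_tsum_le_of_rightInvariant (Γ K : Subgroup G) (hK : IsOpen (K : Set G))
    (hKpos : μ (K : Set G) ≠ 0) (hKfin : μ (K : Set G) ≠ ∞) (hfin : ((Γ : Set G) ∩ (K : Set G)).Finite) {f : G → ℝ}
    (hf0 : ∀ x, 0 ≤ f x) (hfK : ∀ g k : G, k ∈ K → f (g * k) = f g) (hfi : Integrable f μ) :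
    Summable (fun γ : Γ => f γ) ∧
      ∑' γ : Γ, f γ ≤ hfin.toFinset.card * (μ.real (K : Set G))⁻¹ * ∫ x, f x ∂μ := by
  have hb := sum_le_card_mul_measureReal_inv_mul_integral μ Γ K hK hKpos hKfin hfin hf0 hfK hfi
  have hs : Summable (fun γ : Γ => f γ) := summable_of_sum_le (fun γ => hf0 γ) hb
  exact ⟨hs, hs.tsum_le_of_sum_le hb⟩

/-- The same for a measure positive on opens and finite on compacts (e.g. a Haar measure) and a COMPACT open subgroup `K`.
[cite: Garrett2018, §2.2 Thm. 2.2.2 (PDF pp. 82–84)] -/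
theorem summable_and_tsum_le_of_rightInvariant_of_isCompact [μ.IsOpenPosMeasure] [IsFiniteMeasureOnCompacts μ]
    (Γ K : Subgroup G) (hK : IsOpen (K : Set G)) (hKc : IsCompact (K : Set G)) (hfin : ((Γ : Set G) ∩ (K : Set G)).Finite)
    {f : G → ℝ} (hf0 : ∀ x, 0 ≤ f x) (hfK : ∀ g k : G, k ∈ K → f (g * k) = f g) (hfi : Integrable f μ) :
    Summable (fun γ : Γ => f γ) ∧
      ∑' γ : Γ, f γ ≤ hfin.toFinset.card * (μ.real (K : Set G))⁻¹ * ∫ x, f x ∂μ :=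
  summable_and_tsum_le_of_rightInvariant μ Γ K hK (hK.measure_ne_zero μ ⟨1, K.one_mem⟩) hKc.measure_lt_top.ne hfin hf0 hfK hfi

/-! ## §4 (appended) Translated sums `Σ_γ f(w γ)`: ONE bound for every `w ∈ G`; domination form -/

/-- **TRANSLATED LATTICE SUMS, UNIFORMLY IN THE TRANSLATION.**  Under the hypotheses of `summable_and_tsum_le_of_rightInvariant`, for EVERY
`w ∈ G` the family `γ ↦ f(w γ)` is summable over `Γ` and `Σ_{γ ∈ Γ} f(w γ) ≤ |Γ ∩ K| · μ(K)⁻¹ · ∫_G f dμ`: the left translate `f(w ·)` is again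
right-`K`-invariant, non-negative and integrable with the SAME integral (left invariance of `μ`), so the bound does not depend on `w` — this is
the uniformity in the parameter of the orbital sums `Σ_{γ ∈ G'(k)} |⟨ω(h₂⁻¹ γ h₁)φ₁, φ₂⟩|` over `(h₁, h₂)` (no compactness of the parameter set is
needed). [cite: Garrett2018, §2.2 Thm. 2.2.2 (PDF pp. 82–84)] -/
theorem summable_and_tsum_le_translate_of_rightInvariant (Γ K : Subgroup G) (hK : IsOpen (K : Set G))
    (hKpos : μ (K : Set G) ≠ 0) (hKfin : μ (K : Set G) ≠ ∞) (hfin : ((Γ : Set G) ∩ (K : Set G)).Finite) {f : G → ℝ}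
    (hf0 : ∀ x, 0 ≤ f x) (hfK : ∀ g k : G, k ∈ K → f (g * k) = f g) (hfi : Integrable f μ) (w : G) :
    Summable (fun γ : Γ => f (w * γ)) ∧
      ∑' γ : Γ, f (w * γ) ≤ hfin.toFinset.card * (μ.real (K : Set G))⁻¹ * ∫ x, f x ∂μ := by
  have h := summable_and_tsum_le_of_rightInvariant μ Γ K hK hKpos hKfin hfin (f := fun x => f (w * x)) (fun x => hf0 _)
    (fun g k hk => by rw [← mul_assoc]; exact hfK _ k hk) (hfi.comp_mul_left w)
  rwa [integral_mul_left_eq_self] at h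

/-- **DOMINATION FORM**: if `0 ≤ t γ ≤ f(w γ)` on `Γ` (e.g. `t γ = |⟨ω(wγ)Φ₁, Φ₂⟩|` dominated by a `K`-invariant integrable majorant of the
matrix coefficient), then `t` is summable and `Σ_{γ ∈ Γ} t γ ≤ |Γ ∩ K| · μ(K)⁻¹ · ∫_G f dμ`, for every `w ∈ G`.
[cite: Garrett2018, §2.2 Thm. 2.2.2 (PDF pp. 82–84)] -/
theorem summable_and_tsum_le_of_le_translate (Γ K : Subgroup G) (hK : IsOpen (K : Set G))
    (hKpos : μ (K : Set G) ≠ 0) (hKfin : μ (K : Set G) ≠ ∞) (hfin : ((Γ : Set G) ∩ (K : Set G)).Finite) {f : G → ℝ}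
    (hf0 : ∀ x, 0 ≤ f x) (hfK : ∀ g k : G, k ∈ K → f (g * k) = f g) (hfi : Integrable f μ) (w : G) {t : Γ → ℝ}
    (ht0 : ∀ γ, 0 ≤ t γ) (ht : ∀ γ : Γ, t γ ≤ f (w * γ)) :
    Summable t ∧ ∑' γ : Γ, t γ ≤ hfin.toFinset.card * (μ.real (K : Set G))⁻¹ * ∫ x, f x ∂μ := by
  obtain ⟨hs, hb⟩ := summable_and_tsum_le_translate_of_rightInvariant μ Γ K hK hKpos hKfin hfin hf0 hfK hfi w
  have hts : Summable t := hs.of_nonneg_of_le ht0 ht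
  exact ⟨hts, (hts.tsum_le_tsum ht hs).trans hb⟩

/-- The same two statements for a measure positive on opens and finite on compacts (e.g. a Haar measure) and a COMPACT open subgroup `K`:
translated sums. [cite: Garrett2018, §2.2 Thm. 2.2.2 (PDF pp. 82–84)] -/
theorem summable_and_tsum_le_translate_of_rightInvariant_of_isCompact [μ.IsOpenPosMeasure] [IsFiniteMeasureOnCompacts μ]
    (Γ K : Subgroup G) (hK : IsOpen (K : Set G)) (hKc : IsCompact (K : Set G)) (hfin : ((Γ : Set G) ∩ (K : Set G)).Finite)
    {f : G → ℝ} (hf0 : ∀ x, 0 ≤ f x) (hfK : ∀ g k : G, k ∈ K → f (g * k) = f g) (hfi : Integrable f μ) (w : G) :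
    Summable (fun γ : Γ => f (w * γ)) ∧
      ∑' γ : Γ, f (w * γ) ≤ hfin.toFinset.card * (μ.real (K : Set G))⁻¹ * ∫ x, f x ∂μ :=
  summable_and_tsum_le_translate_of_rightInvariant μ Γ K hK (hK.measure_ne_zero μ ⟨1, K.one_mem⟩) hKc.measure_lt_top.ne hfin hf0
    hfK hfi w

/-- … and the domination form for a COMPACT open subgroup `K`. [cite: Garrett2018, §2.2 Thm. 2.2.2 (PDF pp. 82–84)] -/
theorem summable_and_tsum_le_of_le_translate_of_isCompact [μ.IsOpenPosMeasure] [IsFiniteMeasureOnCompacts μ]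
    (Γ K : Subgroup G) (hK : IsOpen (K : Set G)) (hKc : IsCompact (K : Set G)) (hfin : ((Γ : Set G) ∩ (K : Set G)).Finite)
    {f : G → ℝ} (hf0 : ∀ x, 0 ≤ f x) (hfK : ∀ g k : G, k ∈ K → f (g * k) = f g) (hfi : Integrable f μ) (w : G) {t : Γ → ℝ}
    (ht0 : ∀ γ, 0 ≤ t γ) (ht : ∀ γ : Γ, t γ ≤ f (w * γ)) :
    Summable t ∧ ∑' γ : Γ, t γ ≤ hfin.toFinset.card * (μ.real (K : Set G))⁻¹ * ∫ x, f x ∂μ :=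
  summable_and_tsum_le_of_le_translate μ Γ K hK (hK.measure_ne_zero μ ⟨1, K.one_mem⟩) hKc.measure_lt_top.ne hfin hf0 hfK hfi w
    ht0 ht

end Literature.MeasureTheory.Group

end
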